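import Mathlib
import Literature.NumberTheory.LFunctions.Zhang2022.Section7Eq714Mellin
import HarnessLib

/-!
# Zhang (2022), §7.u033 REPAIRED: the per-term bound behind (7.14) with an arbitrary power saving, kernel-checked

Topic `Literature/NumberTheory/LFunctions/Zhang2022` (Landau–Siegel audit tree; verdict-neutral).
Y. Zhang, *Discrete mean estimates and the Landau–Siegel zero*, arXiv:2211.02515v1 (2022)
[Zhang2022LandauSiegel] — **an unrefereed manuscript under adjudication** (cell `siegel-zhang`, D-0069).
DAG nodes `Z22:(7.14)`, `Z22:§7.u033` [Z22 p.38, tex L2009–2019]: "Assume `1 < r < D` and `θ` is a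
primitive character `(mod r)`. By Lemma 5.6, the right side of (7.14) is `≪ hrl⁻¹P²D⁻ᶜ`." As printed
(weight `𝓛ᶜ/(1+t²)`, Lemma 5.6 only for `|t| ≤ D`) this gives `c ≤ 1`, which the aggregation over
`1 < r < D` (`Section7cStatements.Step7bSmallR`) cannot use (GAP-LEDGER G-adj2-1/G-adj2-2). The REPAIR
(Team B): keep the exact Mellin weight `|δ(1+it)|` (`Skeleton.norm_sum_primeWindow_DeltaW_le`), use
Lemma 5.6 on `|t| ≤ D/2` and the rapid decay of `δ(1+it)` beyond (`Skeleton.deltaW_tail_integral_le`):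

* `Skeleton.step7u033_repaired` — **for every `c′`, `A : ℕ` there is `C` with, for all large `D`, under
  (A), for `1 < r < D`, `θ` primitive `(mod r)`, `h, l ≥ 1`: `‖Σ_{p∼P} p^{β₃}θ̄(p)Δ(l/(phr))‖ ≤ C·(hr/l)·P²·D^{−A}`.**

Public plumbing (for the §7.u033 / (14.8) dischargers): `isPrimitive_inv`, `changeLevel_inv_ne_changeLevel`
(Mathlib `conductor_inv`/`conductor_changeLevel`), `pPoly_beta3_eq`, `norm_pPoly_le_frakP`,
`norm_pPoly_beta3_le_of_lemma56` (Lemma 5.6 = tree `Skeleton.lemma56_holds`, at `θ̄ = θ⁻¹`, height `t + Im β₃`),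
`frakP_le_four_mul_bigP_sq`, `exists_mul_ell_pow_le`. NOT here: the `l`/`θ`/`(d,h,r)` aggregation
(`Step7u034`, `Step7bSmallR`); any claim about Prop. 7.1, Theorems 1–2 or Landau–Siegel zeros.

## References

* Y. Zhang, arXiv:2211.02515v1 (2022), §7 (7.14) and the sentence after it, p.38; Lemma 5.6 p.29.
  [cite: Zhang2022LandauSiegel, §7 (7.14); §5 Lemma 5.6]
-/

noncomputable section

open Complex Real Set MeasureTheory Filter Topology
open Literature.NumberTheory.LFunctions.Zhang2022.Section7cStatements (pPoly)

namespace Literature.NumberTheory.LFunctions.Zhang2022.Skeleton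

/-- The inverse of a primitive Dirichlet character is primitive (`conductor θ⁻¹ = conductor θ`).
[folklore] [cite: Zhang2022LandauSiegel, §5 Lemma 5.6] -/
theorem isPrimitive_inv {r : ℕ} {θ : DirichletCharacter ℂ r} (hθ : θ.IsPrimitive) :
    θ⁻¹.IsPrimitive := by
  rw [DirichletCharacter.isPrimitive_def, DirichletCharacter.conductor_inv]
  exact hθ

/-- For primitive `θ (mod r)` and primitive `χ (mod D)` with `r ≠ D`, the lifts of `θ⁻¹` and `χ` to
modulus `Dr` differ (their conductors are `r` and `D`): the hypothesis "`θ̄ ≠ χ`" of Lemma 5.6 at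
`1 < r < D`. [cite: Zhang2022LandauSiegel, §5 Lemma 5.6; §7 p.38] -/
theorem changeLevel_inv_ne_changeLevel {D r : ℕ} [NeZero D] [NeZero r] {χ : DirichletCharacter ℂ D}
    (hχ : χ.IsPrimitive) {θ : DirichletCharacter ℂ r} (hθ : θ.IsPrimitive) (hrD : r ≠ D) :
    DirichletCharacter.changeLevel (Nat.dvd_mul_left r D) θ⁻¹ ≠
      DirichletCharacter.changeLevel (Nat.dvd_mul_right D r) χ := by
  intro h
  haveI : NeZero (D * r) := ⟨mul_ne_zero (NeZero.ne D) (NeZero.ne r)⟩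
  have h1 := congrArg DirichletCharacter.conductor h
  rw [DirichletCharacter.conductor_changeLevel, DirichletCharacter.conductor_changeLevel,
    DirichletCharacter.conductor_inv] at h1
  rw [DirichletCharacter.isPrimitive_def] at hθ hχ
  rw [hθ, hχ] at h1
  exact hrD h1

/-- `pPoly D r θ (1+it+β₃) = Σ_{p∼P} θ̄(p)p^{1+i(t+v₃)}` with `v₃ = 3α(1−c′α𝓛) = Im β₃`: the Lemma-5.6
shape at the shifted height. [cite: Zhang2022LandauSiegel, §7 (7.14); (2.13)] -/
theorem pPoly_beta3_eq (c' : ℝ) (D r : ℕ) (θ : DirichletCharacter ℂ r) (t : ℝ) :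
    pPoly D r θ (1 + t * I + beta3 c' D)
      = ∑ p ∈ primeWindow D, θ⁻¹ (p : ZMod r) *
          (p : ℂ) ^ (1 + ((t + 3 * alpha D * (1 - c' * alpha D * ell D) : ℝ) : ℂ) * I) := by
  unfold pPoly
  refine Finset.sum_congr rfl fun p _ => ?_
  congr 1
  simp only [beta3]
  push_cast
  ring

/-- `‖pPoly D r θ (1+it+β)‖ ≤ 𝔓` for purely imaginary `β` (`|θ̄(p)| ≤ 1`, `|p^{1+it+β}| = p`).
[cite: Zhang2022LandauSiegel, §7 (7.14); (2.9)] -/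
theorem norm_pPoly_le_frakP (D r : ℕ) (θ : DirichletCharacter ℂ r) {β : ℂ} (hβ : β.re = 0) (t : ℝ) :
    ‖pPoly D r θ (1 + t * I + β)‖ ≤ frakP D := by
  rw [frakP_eq_sum_primeWindow]
  unfold pPoly
  refine (norm_sum_le _ _).trans (Finset.sum_le_sum fun p hp => ?_)
  have hp : 0 < p := (Finset.mem_filter.mp hp).2.pos
  have hre : (1 + t * I + β).re = 1 := by simp [hβ]
  rw [norm_mul, Complex.norm_natCast_cpow_of_pos hp, hre, Real.rpow_one]
  calc ‖θ⁻¹ (p : ZMod r)‖ * (p : ℝ) ≤ 1 * p := by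
        gcongr; exact DirichletCharacter.norm_le_one _ _
    _ = p := one_mul _

/-- `𝓛 = log D ≥ 1` for `D ≥ 3`. [folklore] -/
private theorem one_le_ell {D : ℕ} (hD : 3 ≤ D) : 1 ≤ ell D := by
  rw [ell, Real.le_log_iff_exp_le (by exact_mod_cast (show 0 < D by omega))]
  have h3 : (3 : ℝ) ≤ D := by exact_mod_cast hD
  linarith [Real.exp_one_lt_d9]

/-- `α = π/𝓛⁹`. [cite: Zhang2022LandauSiegel, (2.10)] -/
private theorem alpha_eq (D : ℕ) : alpha D = π / ell D ^ 9 := by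
  rw [alpha, bigP, Real.log_exp]

/-- **Lemma 5.6 for the (7.14) polynomial**: under (A), for `1 < r < D`, `θ` primitive `(mod r)` and
`|t| ≤ D/2`, `‖Σ_{p∼P} θ̄(p)p^{1+it+β₃}‖ ≤ C·𝔓·exp(−𝓛^{9/2})` (tree `Skeleton.lemma56_holds` at the height
`t + Im β₃`, `|Im β₃| ≤ 3π(1+|c′|π) ≤ D/2`, with `θ̄ = θ⁻¹` primitive and `≠ χ` since `r < D`).
[cite: Zhang2022LandauSiegel, §5 Lemma 5.6; §7 p.38] -/
theorem norm_pPoly_beta3_le_of_lemma56 (c' : ℝ) :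
    ∃ C : ℝ, ForAllLarge fun D _ χ => AssumptionA D χ →
      ∀ (r : ℕ) (θ : DirichletCharacter ℂ r) (t : ℝ), 1 < r → r < D → θ.IsPrimitive →
        |t| ≤ (D : ℝ) / 2 →
          ‖pPoly D r θ (1 + t * I + beta3 c' D)‖
            ≤ C * frakP D * Real.exp (-(ell D ^ ((9 : ℝ) / 2))) := by
  obtain ⟨C, D₀, h⟩ := lemma56_holds
  refine ⟨C, D₀ + 3 + ⌈2 * (3 * π * (1 + |c'| * π))⌉₊, fun D _ χ hD hq hp hA r θ t hr hrD hθ ht => ?_⟩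
  have hD₀ : D₀ ≤ D := by omega
  have hD3 : 3 ≤ D := by omega
  have hDV : 2 * (3 * π * (1 + |c'| * π)) ≤ (D : ℝ) :=
    le_trans (Nat.le_ceil _) (by exact_mod_cast (show ⌈2 * (3 * π * (1 + |c'| * π))⌉₊ ≤ D by omega))
  haveI : NeZero r := ⟨by omega⟩
  have hℓ1 : 1 ≤ ell D := one_le_ell hD3
  have hD0 : (0 : ℝ) < D := by exact_mod_cast (show 0 < D by omega)
  -- `r < T = exp(𝓛^{1.1})` since `r < D = exp 𝓛 ≤ exp(𝓛^{1.1})`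
  have hrT : (r : ℝ) < bigT D := by
    have h1 : (r : ℝ) < D := by exact_mod_cast hrD
    have h2 : (D : ℝ) ≤ bigT D := by
      have := Real.rpow_le_rpow_of_exponent_le hℓ1 (show (1 : ℝ) ≤ 1.1 by norm_num)
      rw [Real.rpow_one] at this
      calc (D : ℝ) = Real.exp (Real.log D) := (Real.exp_log hD0).symm
        _ ≤ bigT D := Real.exp_le_exp.mpr this
    exact lt_of_lt_of_le h1 h2
  -- the shift `v₃ = 3α(1 − c′α𝓛)` has `|v₃| ≤ 3π(1 + |c′|π) ≤ D/2`
  have hα : alpha D = π / ell D ^ 9 := alpha_eq D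
  have hα0 : 0 ≤ alpha D := by rw [hα]; positivity
  have hαπ : alpha D ≤ π := by rw [hα]; exact div_le_self Real.pi_pos.le (one_le_pow₀ hℓ1)
  have hαℓ : alpha D * ell D ≤ π := by
    rw [hα, div_mul_eq_mul_div, div_le_iff₀ (by positivity)]
    have : ell D ≤ ell D ^ 9 := le_self_pow₀ hℓ1 (by norm_num)
    exact mul_le_mul_of_nonneg_left this Real.pi_pos.le
  have hv : |3 * alpha D * (1 - c' * alpha D * ell D)| ≤ 3 * π * (1 + |c'| * π) := by
    rw [abs_mul, abs_mul, abs_of_nonneg hα0, abs_of_nonneg (by norm_num : (0 : ℝ) ≤ 3)]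
    have h1 : |1 - c' * alpha D * ell D| ≤ 1 + |c'| * π := by
      calc |1 - c' * alpha D * ell D| ≤ |(1 : ℝ)| + |c' * alpha D * ell D| := abs_sub _ _
        _ = 1 + |c'| * (alpha D * ell D) := by
            rw [abs_one, mul_assoc, abs_mul, abs_of_nonneg (mul_nonneg hα0 (by linarith))]
        _ ≤ 1 + |c'| * π := by gcongr
    exact mul_le_mul (by linarith) h1 (abs_nonneg _) (by positivity)
  have htv : |t + 3 * alpha D * (1 - c' * alpha D * ell D)| ≤ D := by
    refine (abs_add_le _ _).trans ?_
    linarith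
  have key := h D χ hD₀ hq hp hA r hr hrT θ⁻¹ (isPrimitive_inv hθ)
    (changeLevel_inv_ne_changeLevel hp hθ (by omega)) _ htv
  rw [pPoly_beta3_eq]
  exact key

/-- `𝔓 ≤ 4P²` for all large `D` (from (2.9), tree `frakP_bounds`: `𝔓 = (1+O(𝓛⁻⁶⁸))P²𝓛⁻⁷⁷`).
[cite: Zhang2022LandauSiegel, (2.9)] -/
theorem frakP_le_four_mul_bigP_sq : ∃ D₁ : ℕ, ∀ D : ℕ, D₁ ≤ D → frakP D ≤ 4 * bigP D ^ 2 := by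
  obtain ⟨D₀, h⟩ := frakP_bounds
  refine ⟨D₀ + 3, fun D hD => ?_⟩
  have hℓ' : 1 ≤ Real.log D := one_le_ell (by omega)
  have hb := (abs_le.mp (h D (by omega))).2
  have hP : bigP D = Real.exp (Real.log D ^ 9) := rfl
  rw [hP]
  set Q : ℝ := Real.exp (Real.log D ^ 9) ^ 2 with hQ
  have hQ0 : 0 ≤ Q := by positivity
  have h1 : Q * (Real.log D ^ 77)⁻¹ ≤ Q :=
    mul_le_of_le_one_right hQ0 (inv_le_one_of_one_le₀ (one_le_pow₀ hℓ'))
  have h2 : 3 * (Real.log D ^ 68)⁻¹ * (Q * (Real.log D ^ 77)⁻¹) ≤ 3 * 1 * Q := by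
    gcongr; exact inv_le_one_of_one_le₀ (one_le_pow₀ hℓ')
  linarith

/-- For every `N` and `B ≥ 0`: `B·𝓛ᴺ ≤ D` for all large `D` (`𝓛ᴺ⁺¹ ≤ (N+1)!·D`), `𝓛 = log D` (2.1).
[cite: Zhang2022LandauSiegel, §2 (2.1)] -/
theorem exists_mul_ell_pow_le (N : ℕ) {B : ℝ} (hB : 0 ≤ B) :
    ∃ D₁ : ℕ, ∀ D : ℕ, D₁ ≤ D → B * ell D ^ N ≤ D := by
  refine ⟨⌈Real.exp (B * (N + 1).factorial)⌉₊ + 3, fun D hD => ?_⟩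
  have hD0 : (0 : ℝ) < D := by exact_mod_cast (show 0 < D by omega)
  have hℓ1 : 1 ≤ ell D := one_le_ell (by omega)
  have hℓ0 : 0 < ell D := by linarith
  have hℓB : B * (N + 1).factorial ≤ ell D := by
    rw [ell, Real.le_log_iff_exp_le hD0]
    exact le_trans (Nat.le_ceil _) (by exact_mod_cast (show ⌈Real.exp (B * (N + 1).factorial)⌉₊ ≤ D by omega))
  have h1 : ell D ^ (N + 1) ≤ (N + 1).factorial * D := by
    have := Real.pow_div_factorial_le_exp (ell D) hℓ0.le (N + 1)
    rw [div_le_iff₀ (by positivity), ell, Real.exp_log hD0] at this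
    rw [ell]; linarith
  have h2 : B * ell D ^ N * ell D ≤ (D : ℝ) * ell D := by
    calc B * ell D ^ N * ell D = B * ell D ^ (N + 1) := by ring
      _ ≤ B * ((N + 1).factorial * D) := by gcongr
      _ = B * (N + 1).factorial * D := by ring
      _ ≤ ell D * D := by gcongr
      _ = (D : ℝ) * ell D := by ring
  exact le_of_mul_le_mul_right h2 hℓ0

/-- `∫_ℝ‖δ(1+it)‖ ≤ K·𝓛⁵¹⁹⁰` (`D ≥ 3`) with one fixed `K ≥ 0` (`Skeleton.integral_norm_deltaW_line_le`).
[cite: Zhang2022LandauSiegel, §5 Lemma 5.4 (i)] -/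
private theorem exists_integral_norm_deltaW_line_le :
    ∃ K : ℝ, 0 ≤ K ∧ ∀ D : ℕ, 3 ≤ D → ∫ t : ℝ, ‖deltaW D (1 + t * I)‖ ≤ K * ell D ^ 5190 := by
  have hJ0 : 0 ≤ Lemma53.Jconst 1 2 := Lemma53.Jconst_nonneg' 1 2
  refine ⟨(2 * Lemma53.Jconst 1 2 + 4 * ((2 + Real.exp 1) * (4 * π) ^ 2
      * Real.exp (((5 : ℕ) : ℝ) ^ 2) + (Real.exp 1 * ((2 * 5).factorial : ℝ) + 5 ^ 5)
      * Lemma53.Jconst 1 2)) * π, by positivity, fun D hD => ?_⟩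
  have := integral_norm_deltaW_line_le hD
  linarith

/-- `𝓛⁵¹⁹⁰·e^{−𝓛^{9/2}} ≤ 2595!·D^{−A}` once `𝓛 ≥ A + 1` (`𝓛^{9/2} ≥ 𝓛³ ≥ 𝓛² + A𝓛`,
`𝓛⁵¹⁹⁰ ≤ 2595!·e^{𝓛²}`, `e^{−A𝓛} = D^{−A}`). [folklore] -/
private theorem ell_pow_mul_exp_neg_le {D : ℕ} (hD : 3 ≤ D) (A : ℕ) (hℓA : (A : ℝ) + 1 ≤ ell D) :
    ell D ^ 5190 * Real.exp (-(ell D ^ ((9 : ℝ) / 2)))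
      ≤ (Nat.factorial 2595 : ℝ) * (D : ℝ) ^ (-(A : ℝ)) := by
  have hℓ1 : 1 ≤ ell D := one_le_ell hD
  have hℓ0 : 0 < ell D := by linarith
  have hD0 : (0 : ℝ) < D := by exact_mod_cast (show 0 < D by omega)
  -- `𝓛^{9/2} ≥ 𝓛³ ≥ 𝓛² + A𝓛`
  have h45 : ell D ^ 3 ≤ ell D ^ ((9 : ℝ) / 2) := by
    have := Real.rpow_le_rpow_of_exponent_le hℓ1 (show ((3 : ℕ) : ℝ) ≤ (9 : ℝ) / 2 by norm_num)
    rwa [Real.rpow_natCast] at this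
  have h3 : ell D ^ 2 + A * ell D ≤ ell D ^ 3 := by
    have hA : (A : ℝ) ≤ ell D - 1 := by linarith
    have h4 : (A : ℝ) * ell D ≤ (ell D - 1) * ell D := mul_le_mul_of_nonneg_right hA hℓ0.le
    nlinarith [mul_nonneg hℓ0.le (sq_nonneg (ell D - 1))]
  -- `𝓛⁵¹⁹⁰ ≤ 2595!·e^{𝓛²}`
  have h5190 : ell D ^ 5190 ≤ (Nat.factorial 2595 : ℝ) * Real.exp (ell D ^ 2) := by
    have := Real.pow_div_factorial_le_exp (ell D ^ 2) (by positivity) 2595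
    rw [div_le_iff₀ (by positivity), ← pow_mul, show 2 * 2595 = 5190 by norm_num] at this
    linarith
  have hDA : (D : ℝ) ^ (-(A : ℝ)) = Real.exp (-(A * ell D)) := by
    rw [Real.rpow_def_of_pos hD0, ell]; congr 1; ring
  rw [hDA]
  calc ell D ^ 5190 * Real.exp (-(ell D ^ ((9 : ℝ) / 2)))
      ≤ ((Nat.factorial 2595 : ℝ) * Real.exp (ell D ^ 2)) * Real.exp (-(ell D ^ 2 + A * ell D)) := by
        refine mul_le_mul h5190 (Real.exp_le_exp.mpr (by linarith)) (Real.exp_nonneg _) (by positivity)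
    _ = (Nat.factorial 2595 : ℝ) * Real.exp (-(A * ell D)) := by
        rw [mul_assoc, ← Real.exp_add]; congr 2; ring

/-- **§7.u033 REPAIRED (Team B, GAP-LEDGER G-adj2-1/G-adj2-2): arbitrary power saving per term.** For every
`c′` and every `A : ℕ` there is `C` such that for all sufficiently large `D`, every real primitive
`χ (mod D)` with (A), every `1 < r < D`, every primitive `θ (mod r)` and all `h, l ≥ 1`:
`‖Σ_{p∼P} p^{β₃} θ̄(p) Δ(l/(phr))‖ ≤ C·(hr/l)·P²·D^{−A}`. Route: the exact-weight (7.14)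
(`norm_sum_primeWindow_DeltaW_le`), Lemma 5.6 on `|t| ≤ D/2` (`norm_pPoly_beta3_le_of_lemma56`) against
`∫_ℝ‖δ(1+it)‖ ≪ 𝓛⁵¹⁹⁰`, and on `|t| > D/2` the trivial `‖pPoly‖ ≤ 𝔓` against the tail
`∫_{|t|≥D/2}‖δ(1+it)‖ ≪ 𝓛ᶜ t₀^{1.03(A+3)} (D/2)^{−(A+1)}` (`deltaW_tail_integral_le`); `𝓛`-powers absorbed
by `exists_mul_ell_pow_le`. [cite: Zhang2022LandauSiegel, §7 (7.14) and p.38; §5 Lemma 5.6] -/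
theorem step7u033_repaired (c' : ℝ) (A : ℕ) :
    ∃ C : ℝ, ForAllLarge fun D _ χ => AssumptionA D χ →
      ∀ (r h l : ℕ) (θ : DirichletCharacter ℂ r), 1 < r → r < D → θ.IsPrimitive → 0 < h → 0 < l →
        ‖∑ p ∈ primeWindow D, (p : ℂ) ^ beta3 c' D * θ⁻¹ (p : ZMod r) *
            DeltaW D ((l : ℝ) / ((p : ℝ) * h * r))‖
          ≤ C * ((((h * r : ℕ) : ℝ)) / l) * bigP D ^ 2 * (D : ℝ) ^ (-(A : ℝ)) := by
  -- the inputs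
  obtain ⟨C56, h56⟩ := norm_pPoly_beta3_le_of_lemma56 c'
  obtain ⟨cT, CT, hT⟩ := deltaW_tail_integral_le (A + 1)
  obtain ⟨K, hK0, hK⟩ := exists_integral_norm_deltaW_line_le
  obtain ⟨D₀, hall⟩ :=
    ((h56.and hT).and (norm_sum_primeWindow_DeltaW_le.and integrable_norm_deltaW_mul_norm_pPoly)).and
      integrable_deltaW_line
  obtain ⟨DP, hPle⟩ := frakP_le_four_mul_bigP_sq
  -- `2·𝓛⁵³⁵ ≤ D` (so `t₀^{1.03} ≤ D/2`) and `2^{A+1}·𝓛^{⌈c⌉+535(A+3)} ≤ D` (so the tail is `≤ |C|·D^{−A}`)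
  obtain ⟨D₁, hD₁⟩ := exists_mul_ell_pow_le 535 (show (0 : ℝ) ≤ 2 by norm_num)
  obtain ⟨D₂, hD₂⟩ := exists_mul_ell_pow_le (⌈cT⌉₊ + 535 * (A + 1 + 2))
    (show (0 : ℝ) ≤ 2 ^ (A + 1) by positivity)
  set M : ℝ := |CT| + |C56| * K * (Nat.factorial 2595 : ℝ) with hM
  refine ⟨4 * (1 / (2 * π)) * M, D₀ + DP + D₁ + D₂ + ⌈Real.exp ((A : ℝ) + 1)⌉₊ + 3,
    fun D _ χ hD hq hp hA r h l θ hr hrD hθ hh hl => ?_⟩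
  obtain ⟨⟨⟨h56D, hTD⟩, ⟨h714, hint⟩⟩, hδint⟩ := hall D χ (by omega) hq hp
  have hD3 : 3 ≤ D := by omega
  have hℓ1 : 1 ≤ ell D := one_le_ell hD3
  have hℓ0 : 0 < ell D := by linarith
  have hD0 : (0 : ℝ) < D := by exact_mod_cast (show 0 < D by omega)
  have hℓA : (A : ℝ) + 1 ≤ ell D := by
    rw [ell, Real.le_log_iff_exp_le hD0]
    exact le_trans (Nat.le_ceil _) (by exact_mod_cast (show ⌈Real.exp ((A : ℝ) + 1)⌉₊ ≤ D by omega))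
  have hP4 : frakP D ≤ 4 * bigP D ^ 2 := hPle D (by omega)
  have hP0 : 0 ≤ frakP D := frakP_eq_sum_primeWindow D ▸ Finset.sum_nonneg fun p _ => Nat.cast_nonneg p
  -- `T₀ = t₀^{1.03} ≤ 𝓛⁵³⁵`, `X = D/2 ≥ T₀`
  have ht00 : 0 ≤ t0 D := pow_nonneg hℓ0.le _
  have hT535 : t0 D ^ (1.03 : ℝ) ≤ ell D ^ 535 := by
    rw [t0, ← Real.rpow_natCast (ell D) 519, ← Real.rpow_mul hℓ0.le, ← Real.rpow_natCast (ell D) 535]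
    exact Real.rpow_le_rpow_of_exponent_le hℓ1 (by norm_num)
  have hT0nn : 0 ≤ t0 D ^ (1.03 : ℝ) := Real.rpow_nonneg ht00 _
  have hX : t0 D ^ (1.03 : ℝ) ≤ (D : ℝ) / 2 := by
    have := hD₁ D (by omega); linarith
  have hX0 : 0 < (D : ℝ) / 2 := by positivity
  obtain ⟨hSint, hStail⟩ := hTD ((D : ℝ) / 2) hX
  -- the exact-weight (7.14)
  have h1 := h714 r h l θ (beta3 c' D) (by omega) hh hl
  have hfi := hint r θ (beta3 c' D)
  set f : ℝ → ℝ := fun t => ‖deltaW D (1 + t * I)‖ * ‖pPoly D r θ (1 + t * I + beta3 c' D)‖ with hf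
  set S : Set ℝ := {t : ℝ | (D : ℝ) / 2 ≤ |t|} with hS
  have hSm : MeasurableSet S := (isClosed_le continuous_const continuous_abs).measurableSet
  have hβre : (beta3 c' D).re = 0 := by simp [beta3]
  -- the tail part `|t| ≥ D/2`
  have hfS : ∫ t in S, f t ≤ frakP D * (|CT| * ell D ^ cT * (t0 D ^ (1.03 : ℝ)) ^ (A + 1 + 2) *
      ((D : ℝ) / 2) ^ (-((A + 1 : ℕ) : ℝ))) := by
    have hg : IntegrableOn (fun t : ℝ => frakP D * ‖deltaW D (1 + t * I)‖) S := hSint.norm.const_mul _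
    calc ∫ t in S, f t ≤ ∫ t in S, frakP D * ‖deltaW D (1 + t * I)‖ := by
          refine setIntegral_mono_on hfi.integrableOn hg hSm fun t _ => ?_
          simp only [hf]
          rw [mul_comm (frakP D)]
          exact mul_le_mul_of_nonneg_left (norm_pPoly_le_frakP D r θ hβre t) (norm_nonneg _)
      _ = frakP D * ∫ t in S, ‖deltaW D (1 + t * I)‖ := integral_const_mul _ _
      _ ≤ frakP D * (|CT| * ell D ^ cT * (t0 D ^ (1.03 : ℝ)) ^ (A + 1 + 2) *
          ((D : ℝ) / 2) ^ (-((A + 1 : ℕ) : ℝ))) := by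
          refine mul_le_mul_of_nonneg_left (hStail.trans ?_) hP0
          have : 0 ≤ ell D ^ cT * (t0 D ^ (1.03 : ℝ)) ^ (A + 1 + 2) * ((D : ℝ) / 2) ^ (-((A + 1 : ℕ) : ℝ)) :=
            mul_nonneg (mul_nonneg (Real.rpow_nonneg hℓ0.le _) (pow_nonneg hT0nn _))
              (Real.rpow_nonneg hX0.le _)
          calc CT * ell D ^ cT * (t0 D ^ (1.03 : ℝ)) ^ (A + 1 + 2) * ((D : ℝ) / 2) ^ (-((A + 1 : ℕ) : ℝ))
              = CT * (ell D ^ cT * (t0 D ^ (1.03 : ℝ)) ^ (A + 1 + 2) *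
                  ((D : ℝ) / 2) ^ (-((A + 1 : ℕ) : ℝ))) := by ring
            _ ≤ |CT| * (ell D ^ cT * (t0 D ^ (1.03 : ℝ)) ^ (A + 1 + 2) *
                  ((D : ℝ) / 2) ^ (-((A + 1 : ℕ) : ℝ))) :=
                mul_le_mul_of_nonneg_right (le_abs_self _) this
            _ = _ := by ring
  -- the central part `|t| < D/2` (Lemma 5.6)
  have hfSc : ∫ t in Sᶜ, f t ≤ |C56| * frakP D * Real.exp (-(ell D ^ ((9 : ℝ) / 2))) *
      (K * ell D ^ 5190) := by
    set B : ℝ := |C56| * frakP D * Real.exp (-(ell D ^ ((9 : ℝ) / 2))) with hB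
    have hB0 : 0 ≤ B := by positivity
    have hg : IntegrableOn (fun t : ℝ => B * ‖deltaW D (1 + t * I)‖) Sᶜ :=
      (hδint.norm.const_mul B).integrableOn
    calc ∫ t in Sᶜ, f t ≤ ∫ t in Sᶜ, B * ‖deltaW D (1 + t * I)‖ := by
          refine setIntegral_mono_on hfi.integrableOn hg hSm.compl fun t ht => ?_
          have ht' : |t| ≤ (D : ℝ) / 2 := by
            rw [Set.mem_compl_iff, hS, Set.mem_setOf_eq, not_le] at ht; exact ht.le
          have hp56 := h56D hA r θ t hr hrD hθ ht'
          simp only [hf]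
          rw [mul_comm B]
          refine mul_le_mul_of_nonneg_left (hp56.trans ?_) (norm_nonneg _)
          rw [hB]
          gcongr
          exact le_abs_self C56
      _ = B * ∫ t in Sᶜ, ‖deltaW D (1 + t * I)‖ := integral_const_mul _ _
      _ ≤ B * ∫ t : ℝ, ‖deltaW D (1 + t * I)‖ :=
          mul_le_mul_of_nonneg_left
            (setIntegral_le_integral hδint.norm (Eventually.of_forall fun t => norm_nonneg _)) hB0
      _ ≤ B * (K * ell D ^ 5190) := mul_le_mul_of_nonneg_left (hK D hD3) hB0
  -- absorbing the powers of `𝓛`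
  have hterm1 : |C56| * frakP D * Real.exp (-(ell D ^ ((9 : ℝ) / 2))) * (K * ell D ^ 5190)
      ≤ frakP D * (|C56| * K * (Nat.factorial 2595 : ℝ) * (D : ℝ) ^ (-(A : ℝ))) := by
    have h := ell_pow_mul_exp_neg_le hD3 A hℓA
    have h0 : 0 ≤ |C56| * frakP D * K := by positivity
    calc |C56| * frakP D * Real.exp (-(ell D ^ ((9 : ℝ) / 2))) * (K * ell D ^ 5190)
        = (|C56| * frakP D * K) * (ell D ^ 5190 * Real.exp (-(ell D ^ ((9 : ℝ) / 2)))) := by ring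
      _ ≤ (|C56| * frakP D * K) * ((Nat.factorial 2595 : ℝ) * (D : ℝ) ^ (-(A : ℝ))) :=
          mul_le_mul_of_nonneg_left h h0
      _ = _ := by ring
  have hterm2 : |CT| * ell D ^ cT * (t0 D ^ (1.03 : ℝ)) ^ (A + 1 + 2) *
      ((D : ℝ) / 2) ^ (-((A + 1 : ℕ) : ℝ)) ≤ |CT| * (D : ℝ) ^ (-(A : ℝ)) := by
    -- `𝓛^{c} T₀^{A+3} 2^{A+1} ≤ D`
    have hc : ell D ^ cT ≤ ell D ^ ⌈cT⌉₊ := by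
      rw [← Real.rpow_natCast (ell D) ⌈cT⌉₊]
      exact Real.rpow_le_rpow_of_exponent_le hℓ1 (Nat.le_ceil cT)
    have hTpow : (t0 D ^ (1.03 : ℝ)) ^ (A + 1 + 2) ≤ ell D ^ (535 * (A + 1 + 2)) := by
      rw [pow_mul]; exact pow_le_pow_left₀ hT0nn hT535 (A + 1 + 2)
    have hmain : 2 ^ (A + 1) * (ell D ^ cT * (t0 D ^ (1.03 : ℝ)) ^ (A + 1 + 2)) ≤ (D : ℝ) := by
      have h2 := hD₂ D (by omega)
      calc 2 ^ (A + 1) * (ell D ^ cT * (t0 D ^ (1.03 : ℝ)) ^ (A + 1 + 2))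
          ≤ 2 ^ (A + 1) * (ell D ^ ⌈cT⌉₊ * ell D ^ (535 * (A + 1 + 2))) :=
            mul_le_mul_of_nonneg_left
              (mul_le_mul hc hTpow (pow_nonneg hT0nn _) (pow_nonneg hℓ0.le _)) (by positivity)
        _ = 2 ^ (A + 1) * ell D ^ (⌈cT⌉₊ + 535 * (A + 1 + 2)) := by rw [← pow_add]
        _ ≤ D := h2
    have e1 : ((D : ℝ) / 2) ^ (-((A + 1 : ℕ) : ℝ)) = 2 ^ (A + 1) / ((D : ℝ) * (D : ℝ) ^ A) := by
      rw [Real.rpow_neg hX0.le, Real.rpow_natCast, div_pow, inv_div, pow_succ' (D : ℝ) A]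
    have e2 : (D : ℝ) ^ (-(A : ℝ)) = ((D : ℝ) ^ A)⁻¹ := by rw [Real.rpow_neg hD0.le, Real.rpow_natCast]
    rw [e1, e2]
    have hDA : 0 < (D : ℝ) * (D : ℝ) ^ A := by positivity
    have hq : ell D ^ cT * (t0 D ^ (1.03 : ℝ)) ^ (A + 1 + 2) * (2 ^ (A + 1) / ((D : ℝ) * (D : ℝ) ^ A))
        ≤ ((D : ℝ) ^ A)⁻¹ := by
      rw [mul_div_assoc', div_le_iff₀ hDA]
      calc ell D ^ cT * (t0 D ^ (1.03 : ℝ)) ^ (A + 1 + 2) * 2 ^ (A + 1)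
          = 2 ^ (A + 1) * (ell D ^ cT * (t0 D ^ (1.03 : ℝ)) ^ (A + 1 + 2)) := by ring
        _ ≤ D := hmain
        _ = ((D : ℝ) ^ A)⁻¹ * ((D : ℝ) * (D : ℝ) ^ A) := by
            rw [mul_comm (D : ℝ) ((D : ℝ) ^ A), ← mul_assoc,
              inv_mul_cancel₀ (pow_ne_zero _ hD0.ne'), one_mul]
    calc |CT| * ell D ^ cT * (t0 D ^ (1.03 : ℝ)) ^ (A + 1 + 2) * (2 ^ (A + 1) / ((D : ℝ) * (D : ℝ) ^ A))
        = |CT| * (ell D ^ cT * (t0 D ^ (1.03 : ℝ)) ^ (A + 1 + 2) *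
            (2 ^ (A + 1) / ((D : ℝ) * (D : ℝ) ^ A))) := by ring
      _ ≤ |CT| * ((D : ℝ) ^ A)⁻¹ := mul_le_mul_of_nonneg_left hq (abs_nonneg _)
  -- assembling
  have hsplit : ∫ t : ℝ, f t = (∫ t in S, f t) + ∫ t in Sᶜ, f t := (integral_add_compl hSm hfi).symm
  have hI : ∫ t : ℝ, f t ≤ frakP D * (M * (D : ℝ) ^ (-(A : ℝ))) := by
    rw [hsplit, hM]
    have := add_le_add (hfS.trans (mul_le_mul_of_nonneg_left hterm2 hP0)) (hfSc.trans hterm1)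
    linarith [this]
  have hhr : 0 ≤ (((h * r : ℕ) : ℝ)) / l := by positivity
  have h2π : 0 ≤ (1 / (2 * π) : ℝ) := by positivity
  have hM0 : 0 ≤ M := by positivity
  have hDA0 : 0 ≤ (D : ℝ) ^ (-(A : ℝ)) := Real.rpow_nonneg hD0.le _
  calc ‖∑ p ∈ primeWindow D, (p : ℂ) ^ beta3 c' D * θ⁻¹ (p : ZMod r) *
          DeltaW D ((l : ℝ) / ((p : ℝ) * h * r))‖
      ≤ (((h * r : ℕ) : ℝ) / l) * (1 / (2 * π)) * ∫ t : ℝ, f t := h1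
    _ ≤ (((h * r : ℕ) : ℝ) / l) * (1 / (2 * π)) * (frakP D * (M * (D : ℝ) ^ (-(A : ℝ)))) :=
        mul_le_mul_of_nonneg_left hI (mul_nonneg hhr h2π)
    _ ≤ (((h * r : ℕ) : ℝ) / l) * (1 / (2 * π)) * ((4 * bigP D ^ 2) * (M * (D : ℝ) ^ (-(A : ℝ)))) := by
        gcongr
    _ = 4 * (1 / (2 * π)) * M * ((((h * r : ℕ) : ℝ)) / l) * bigP D ^ 2 * (D : ℝ) ^ (-(A : ℝ)) := by
        ring

end Literature.NumberTheory.LFunctions.Zhang2022.Skeleton
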